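import Mathlib.RingTheory.Polynomial.Resultant.Basic
import Mathlib.LinearAlgebra.Lagrange
import Mathlib.Analysis.Complex.Polynomial.Basic
import Mathlib.RingTheory.IntegralClosure.IntegrallyClosed
import Mathlib.RingTheory.IntegralClosure.Algebra.Basic
import Mathlib.Algebra.Polynomial.Lifts
import Mathlib.RingTheory.Polynomial.RationalRoot
import HarnessLib

/-!
# The integral shape lemma: an integer geometric resolution of a finite set of algebraic points

Topic `Literature/RingTheory/ZeroDimensional`, companion of `RationalShapeLemma.lean`. Let
`V` be a finite set, `y : V → ℂ` injective with ALGEBRAIC INTEGER values (the values of a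
separating integer linear form at the points of a finite variety, after clearing denominators),
and suppose the monic rational polynomial `μ_ℚ ∈ ℚ[T]` satisfies `μ_ℚ = ∏_{z ∈ V} (T - y_z)` over
`ℂ` (the conclusion of the rational shape lemma). Then:

* `exists_int_poly_eq_nodal` — `μ_ℚ` has INTEGER coefficients: there is a monic `μ ∈ ℤ[T]` of
  degree `|V|` with `μ = ∏_{z ∈ V} (T - y_z)` over `ℂ`, and the integer
  `D := Res(μ, μ') ≠ 0` equals `∏_{z ∈ V} μ'(y_z)` (Mathlib's `resultant_eq_prod_eval`);
* `exists_int_interpolant` — for a "coordinate" `t : V → ℂ` with `c · t_z` algebraic integers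
  (`c ∈ ℕ` a common denominator) which is a rational polynomial in `y` on `V`
  (`t_z = v(y_z)`, `v ∈ ℚ[T]`, `deg v < |V|`, again from the rational shape lemma), the explicit
  Lagrange–Euler interpolant
  `W = ∑_{z ∈ V} (c t_z) (∏_{z' ≠ z} μ'(y_{z'})) ∏_{z' ≠ z} (T - y_{z'}) ∈ ℂ[T]`
  has coefficients which are algebraic integers (visibly) and rational (`W = cD · v` by the
  uniqueness of interpolation, as `W(y_z) = c D t_z`), hence integers: `W` is the image of some
  `w ∈ ℤ[T]` of degree `< |V|` with `c D t_z = w(y_z)` for all `z ∈ V`.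

Dividing by `λ = c|D|` this is the integral form "`x_i = λ⁻¹ v_i(ℓ(x))`, `λ` a positive
integer, `v_i ∈ ℤ[Y]`" of a geometric resolution (Krick–Pardo 1996, Prop. 27 (2), as used by
Bürgisser, TCS 235 (2000), proof of Thm. 4.5, p. 82), obtained here by elementary means and with
an explicit formula whose archimedean size is bounded in `IntegralShapeLemmaBounds.lean` by the
triangle inequality alone — this is what makes the height of the resolution controllable by the
heights of the POINTS (no conjugates or Galois action are needed: a rational algebraic integer is
an integer, and its size is its complex absolute value).

## Content (namespace `Literature.RingTheory.ZeroDimensional`, everything proved)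

* `exists_int_of_isIntegral_ratCast`, `exists_int_poly_of_isIntegral_coeff` — rational algebraic
  integers are integers (`ℤ` is integrally closed), coefficientwise for polynomials;
* `isIntegral_coeff_nodal` — `∏ (T - y_z)` has algebraic-integer coefficients;
* `exists_int_poly_eq_nodal`, `exists_int_interpolant` — as above.

## References

* T. Krick, L. M. Pardo, *A computational method for Diophantine approximation*, Progr. Math.
  143 (1996) 193–253, Prop. 27. [KrickPardo1996]
* P. Bürgisser, *Cook's versus Valiant's hypothesis*, TCS 235 (2000) 71–88, proof of Thm. 4.5,
  p. 82. [Burgisser2000TCS]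
* F. Rouillier, *Solving zero-dimensional systems through the rational univariate
  representation*, AAECC 9 (1999) 433–461, §3 (the same interpolation formulas). [Rouillier1999]
-/

noncomputable section

open Polynomial Lagrange

namespace Literature.RingTheory.ZeroDimensional

/-- A rational number which is an algebraic integer (inside `ℂ`) is an integer. [folklore] -/
theorem exists_int_of_isIntegral_ratCast {q : ℚ} (h : IsIntegral ℤ ((q : ℂ))) :
    ∃ m : ℤ, (m : ℚ) = q := by
  have h' : IsIntegral ℤ q := by
    refine (isIntegral_algHom_iff (IsScalarTower.toAlgHom ℤ ℚ ℂ)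
      (algebraMap ℚ ℂ).injective).mp ?_
    simpa using h
  obtain ⟨m, hm⟩ := IsIntegrallyClosed.algebraMap_eq_of_integral h'
  exact ⟨m, by simpa using hm⟩

/-- A complex polynomial whose coefficients are both rational (it is the image of `p : ℚ[X]`) and
algebraic integers is the image of an integer polynomial of the same degree. [folklore] -/
theorem exists_int_poly_of_isIntegral_coeff (p : ℚ[X])
    (h : ∀ n, IsIntegral ℤ ((p.map (algebraMap ℚ ℂ)).coeff n)) :
    ∃ q : ℤ[X], q.map (Int.castRingHom ℚ) = p ∧ q.degree = p.degree := by
  apply exists_degree_eq_of_mem_lifts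
  rw [lifts_iff_coeff_lifts]
  intro n
  have hn := h n
  rw [coeff_map] at hn
  obtain ⟨m, hm⟩ := exists_int_of_isIntegral_ratCast (by simpa using hn)
  exact ⟨m, by simpa using hm⟩

/-- The coefficients of `∏_{z ∈ s} (X - y_z)` are algebraic integers when the `y_z` are. [folklore] -/
theorem isIntegral_coeff_nodal {α : Type*} (s : Finset α) (y : α → ℂ)
    (hy : ∀ z ∈ s, IsIntegral ℤ (y z)) (n : ℕ) : IsIntegral ℤ ((nodal s y).coeff n) := by
  classical
  -- work in the ring of algebraic integers
  set O := integralClosure ℤ ℂ with hO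
  set yO : α → O := fun z => if hz : z ∈ s then ⟨y z, (mem_integralClosure_iff ℤ ℂ).2 (hy z hz)⟩ else 0
  have hmap : (nodal s yO).map (algebraMap O ℂ) = nodal s y := by
    rw [nodal, nodal, Polynomial.map_prod]
    refine Finset.prod_congr rfl fun z hz => ?_
    rw [Polynomial.map_sub, map_X, map_C]
    congr 2
    simp [yO, hz]
  rw [← hmap, coeff_map]
  exact (mem_integralClosure_iff ℤ ℂ).1 ((nodal s yO).coeff n).2

/-- **The minimal polynomial of the separating form is integral, and its discriminant-type
resultant.** If `y : V → ℂ` is injective on the finite set `V` with algebraic-integer values and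
the monic `μ_ℚ ∈ ℚ[T]` equals `∏_{z ∈ V} (T - y_z)` over `ℂ`, then `μ_ℚ` lifts to a monic
`μ ∈ ℤ[T]` of degree `|V|` with `μ = ∏_{z ∈ V} (T - y_z)` over `ℂ`, and `D = Res(μ, μ') ∈ ℤ` is
nonzero and equals `∏_{z ∈ V} μ'(y_z)` (the `λ`-denominator of Krick–Pardo's Prop. 27 (2) in the
form used by Bürgisser 2000 TCS, p. 82). [cite: KrickPardo1996, Prop. 27] -/
theorem exists_int_poly_eq_nodal {α : Type*} [DecidableEq α] (V : Finset α) (y : α → ℂ)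
    (hinj : Set.InjOn y V) (hy : ∀ z ∈ V, IsIntegral ℤ (y z)) (μℚ : ℚ[X]) (hμℚ : μℚ.Monic)
    (hprod : μℚ.map (algebraMap ℚ ℂ) = nodal V y) :
    ∃ (μ : ℤ[X]) (D : ℤ), μ.Monic ∧ μ.natDegree = V.card ∧
      μ.map (Int.castRingHom ℂ) = nodal V y ∧ D ≠ 0 ∧
      (D : ℂ) = ∏ z ∈ V, (derivative (nodal V y)).eval (y z) := by
  classical
  -- lift `μℚ` to `ℤ[X]`
  have hcoeff : ∀ n, IsIntegral ℤ ((μℚ.map (algebraMap ℚ ℂ)).coeff n) := by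
    intro n; rw [hprod]; exact isIntegral_coeff_nodal V y hy n
  obtain ⟨μ, hμmap, hμdeg⟩ := exists_int_poly_of_isIntegral_coeff μℚ hcoeff
  have hμC : μ.map (Int.castRingHom ℂ) = nodal V y := by
    rw [← hprod, ← hμmap, Polynomial.map_map]
    congr 1
  have hμmonic : μ.Monic := by
    have h1 : (μ.map (Int.castRingHom ℚ)).Monic := by rw [hμmap]; exact hμℚ
    exact monic_of_injective (Int.castRingHom ℚ).injective_int h1
  have hN : μ.natDegree = V.card := by
    have := congr_arg natDegree hμC
    rwa [natDegree_map_eq_of_injective (Int.castRingHom ℂ).injective_int, natDegree_nodal] at this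
  -- `D = Res(μ, μ')`, computed over `ℂ` through the roots `y_z` of `μ`
  set D : ℤ := μ.resultant (derivative μ) with hDdef
  have hroots : (nodal V y).roots = V.val.map y := by
    have : nodal V y = ((V.val.map y).map fun a => X - C a).prod := by
      rw [nodal, Finset.prod_eq_multiset_prod, Multiset.map_map]; rfl
    rw [this, roots_multiset_prod_X_sub_C]
  have hDC : (D : ℂ) = ∏ z ∈ V, (derivative (nodal V y)).eval (y z) := by
    have h1 : (Int.castRingHom ℂ) D = resultant (μ.map (Int.castRingHom ℂ))
        ((derivative μ).map (Int.castRingHom ℂ)) μ.natDegree (derivative μ).natDegree := by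
      rw [hDdef, resultant_map_map]
    rw [eq_intCast] at h1
    rw [h1, ← Polynomial.derivative_map, hμC, natDegree_derivative, hN]
    have hsplit : (nodal V y).Splits := IsAlgClosed.splits _
    have hdegle : (derivative (nodal V y)).natDegree ≤ V.card - 1 := by
      rw [natDegree_derivative, natDegree_nodal]
    have h2 := resultant_eq_prod_eval (nodal V y) (derivative (nodal V y)) (V.card - 1) hdegle hsplit
    rw [natDegree_nodal] at h2
    rw [h2, (nodal_monic (s := V) (v := y)).leadingCoeff, one_pow, one_mul, hroots,
      Multiset.map_map, Finset.prod_eq_multiset_prod]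
    rfl
  have hD0 : D ≠ 0 := by
    have : (D : ℂ) ≠ 0 := by
      rw [hDC]
      refine Finset.prod_ne_zero_iff.2 fun z hz => ?_
      rw [eval_nodal_derivative_eval_node_eq hz, eval_nodal]
      refine Finset.prod_ne_zero_iff.2 fun z' hz' => sub_ne_zero.2 ?_
      obtain ⟨hne, hz'V⟩ := Finset.mem_erase.1 hz'
      exact fun h => hne (hinj hz'V hz h.symm)
    exact_mod_cast this
  exact ⟨μ, D, hμmonic, hN, hμC, hD0, hDC⟩

/-- **The integral interpolant** (Krick–Pardo 1996, Prop. 27 (2) "`x_i = λ⁻¹ v_i(ℓ(x))` with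
`v_i ∈ ℤ[Y]`", as used by Bürgisser 2000 TCS, p. 82; here with `λ = c D`). Let `y : V → ℂ` be
injective on the finite set `V` with algebraic-integer values, `D ∈ ℤ` with
`D = ∏_{z ∈ V} μ'(y_z)` for `μ = ∏_{z ∈ V}(T - y_z)`, `c ∈ ℕ`, and `t : V → ℂ` with `c t_z`
algebraic integers and `t_z = v(y_z)` on `V` for some `v ∈ ℚ[T]` of degree `< |V|`. Then the
interpolant `W = ∑_z (c t_z)(∏_{z' ≠ z} μ'(y_{z'})) ∏_{z' ≠ z}(T - y_{z'})` is the image of an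
integer polynomial `w` of degree `< |V|`, and `c D t_z = w(y_z)` for all `z ∈ V`.
[cite: KrickPardo1996, Prop. 27] -/
theorem exists_int_interpolant {α : Type*} [DecidableEq α] (V : Finset α) (y : α → ℂ)
    (hinj : Set.InjOn y V) (hy : ∀ z ∈ V, IsIntegral ℤ (y z))
    (D : ℤ) (hD : (D : ℂ) = ∏ z ∈ V, (derivative (nodal V y)).eval (y z))
    (c : ℕ) (t : α → ℂ) (ht : ∀ z ∈ V, IsIntegral ℤ ((c : ℂ) * t z))
    (v : ℚ[X]) (hvdeg : v.degree < V.card) (hv : ∀ z ∈ V, t z = aeval (y z) v) :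
    ∃ w : ℤ[X], w.degree < V.card ∧
      w.map (Int.castRingHom ℂ) =
        ∑ z ∈ V, C ((c : ℂ) * t z * ∏ z' ∈ V.erase z, (derivative (nodal V y)).eval (y z')) *
          nodal (V.erase z) y ∧
      ∀ z ∈ V, (c : ℂ) * D * t z = aeval (y z) w := by
  classical
  set A : α → ℂ := fun z => ∏ z' ∈ V.erase z, (derivative (nodal V y)).eval (y z') with hA
  set W : ℂ[X] := ∑ z ∈ V, C ((c : ℂ) * t z * A z) * nodal (V.erase z) y with hW
  -- values of `W` at the nodes
  have hWeval : ∀ z ∈ V, W.eval (y z) = (c : ℂ) * D * t z := by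
    intro z hz
    rw [hW, eval_finsetSum, Finset.sum_eq_single_of_mem z hz]
    · rw [eval_mul, eval_C, ← eval_nodal_derivative_eval_node_eq hz, hD,
        ← Finset.prod_erase_mul _ _ hz]
      ring
    · intro z' hz' hne
      rw [eval_mul, eval_nodal_at_node (Finset.mem_erase.2 ⟨Ne.symm hne, hz⟩), mul_zero]
  -- degree of `W`
  have hWdeg : W.degree < V.card := by
    rcases Nat.eq_zero_or_pos V.card with h0 | hpos
    · have hV0 : V = ∅ := Finset.card_eq_zero.1 h0
      rw [hW, hV0]
      simp
    rw [hW]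
    refine (degree_sum_le _ _).trans_lt ((Finset.sup_lt_iff (WithBot.bot_lt_coe _)).2 ?_)
    intro z hz
    calc (C ((c : ℂ) * t z * A z) * nodal (V.erase z) y).degree
        ≤ (C ((c : ℂ) * t z * A z)).degree + (nodal (V.erase z) y).degree := degree_mul_le _ _
      _ ≤ 0 + (nodal (V.erase z) y).degree := by gcongr; exact degree_C_le
      _ = ((V.card - 1 : ℕ) : WithBot ℕ) := by
          rw [zero_add, degree_nodal, Finset.card_erase_of_mem hz]
      _ < V.card := by exact_mod_cast Nat.sub_lt hpos one_pos
  -- `W = (cD) • v`; in particular the coefficients of `W` are rational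
  have hWv : W = ((c : ℂ) * D) • v.map (algebraMap ℚ ℂ) := by
    apply eq_of_degrees_lt_of_eval_finset_eq (V.image y)
    · rwa [Finset.card_image_of_injOn hinj]
    · rw [Finset.card_image_of_injOn hinj]
      exact (degree_smul_le _ _).trans_lt (by rwa [degree_map])
    · intro x hx
      obtain ⟨z, hz, rfl⟩ := Finset.mem_image.1 hx
      rw [hWeval z hz, eval_smul, eval_map_algebraMap, ← hv z hz, smul_eq_mul]
  -- the coefficients of `W` are algebraic integers
  have hderiv : ∀ z' ∈ V, IsIntegral ℤ ((derivative (nodal V y)).eval (y z')) := by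
    intro z' hz'
    rw [eval_nodal_derivative_eval_node_eq hz', eval_nodal]
    exact IsIntegral.prod _ fun z'' hz'' => (hy z' hz').sub (hy z'' (Finset.mem_of_mem_erase hz''))
  have hWint : ∀ n, IsIntegral ℤ (W.coeff n) := by
    intro n
    rw [hW, finsetSum_coeff]
    refine IsIntegral.sum _ fun z hz => ?_
    rw [coeff_C_mul]
    refine ((ht z hz).mul (IsIntegral.prod _ fun z' hz' => hderiv z' (Finset.mem_of_mem_erase hz'))).mul ?_
    exact isIntegral_coeff_nodal _ _ (fun z' hz' => hy z' (Finset.mem_of_mem_erase hz')) n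
  -- hence `W` is the image of an integer polynomial
  set vℚ : ℚ[X] := ((c : ℚ) * D) • v with hvℚ
  have hvℚmap : vℚ.map (algebraMap ℚ ℂ) = W := by
    rw [hWv, hvℚ, Polynomial.map_smul]
    simp
  obtain ⟨w, hwmap, hwdeg⟩ := exists_int_poly_of_isIntegral_coeff vℚ
    (fun n => by rw [hvℚmap]; exact hWint n)
  have hwC : w.map (Int.castRingHom ℂ) = W := by
    rw [← hvℚmap, ← hwmap, Polynomial.map_map]
    congr 1
  refine ⟨w, ?_, hwC, fun z hz => ?_⟩
  · rw [hwdeg, hvℚ]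
    exact (degree_smul_le _ _).trans_lt hvdeg
  · rw [aeval_def, algebraMap_int_eq, ← eval_map, hwC, hWeval z hz]

end Literature.RingTheory.ZeroDimensional

end
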